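import Summits.BirchSwinnertonDyer.BirchSwinnertonDyer.Theorems.Rank1ResidualJetPairingCountingSigns
import HarnessLib

/-!
# T1 JET (cell `bsd-jet`), road K: the involution on `Π_{v∈T} X_v` induced by a PLACE INVOLUTION
# `v ↦ v̄` and per-place transport maps — every hypothesis of the sign-by-sign Poitou–Tate counting
# theorems for product groups, reduced to PER-PLACE statements (pure algebra; stub S1, Galois half, step 1)

HONEST FRAMING (programme file `BSD-LIT2PART-PROGRAMME-v1.md` §HONESTY, verbatim): «no tranche here
proves BSD; ARM L moves the LITERAL column of an r ≤ 1 census into the kernel-proved-modulo-named-print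
column; ARM P changes what «named print» is worth.» THEOREMS ONLY (seat `bsd-jet-pv-1`, session g4;
`--supports stmt-BirchSwinnertonDyer-14418`, helper): no definition, no named fact, no `sorry`;
PURE ALGEBRA. Nothing is booked; 0 classes move.

## Why (stub S1 of the (J∥) kernel line, sheets `HOME/sheets/PV2-J6-KERNEL.md` §2,
## `PV2-J6-KERNEL.ADDENDUM-1.md` §2, `PV1-ROADK-PTCOUNT.md` §2 (a))

The sign-by-sign counting theorems `GlobalDuality.relIndex_mul_relIndex_eq_of_iInf_ker_sup_plus ∕ _minus`
(`Rank1ResidualJetPairingCountingSigns.lean`) take involutions `τ_X`, `τ_Y` of `X`, `Y` with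
`⟨τ_X x, τ_Y y⟩ = ⟨x, y⟩` and `τ`-stable `F ≤ G`, `L`, `L'`. In Jetchev 2008 §5 (p. 822, Thm. 5.1 «on the
`±`-eigenspaces … with respect to `∑_v ⟨,⟩_v^±`») `X = ⊕_{v∈T} H¹(K_v, E[p^m])`, and complex conjugation
`τ ∈ Gal(K/ℚ)` acts on it THROUGH THE PLACES: it permutes `T` (`v ↦ v̄`; `v̄ = v` at inert places) and
carries `H¹(K_v, ·)` to `H¹(K_v̄, ·)` by transport of structure along `K_v ≃ K_v̄` (Cassels–Fröhlich,
Ch. VII §1.1; in the tree `galAdicCompletionEquiv`, `conjAct_mem_selmerLocalKer_iff`). This file is the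
pure-algebra bookkeeping of that passage, in the definition-free style of the companion files: for an
involution `π` of a finite index type `ι`, families `X_i`, `Y_i`, TOTAL transport families
`eX i j : X_i → X_j`, `eY i j : Y_i → Y_j` (only the pairs `(π j, j)` matter) and endomorphisms
`τ_X`, `τ_Y` with `(τ_X x)_j = eX (π j) j (x_{π j})` (hypotheses `hτX`, `hτY`; such maps exist,
`piTransport_exists`):

* §1 `piTransport_involutive` — `τ_X² = 1` from the per-place round trip `eX (π j) j ∘ eX j (π j) = id`;
  `sum_pairing_piTransport` — `∑_i b_i` is `(τ_X, τ_Y)`-invariant from the per-place adjointness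
  `b_j (eX x) (eY y) = b_{π j} x y` (reindexing by `π`); `piTransport_mem_pi` — `Π_i F_i` is `τ_X`-stable
  iff-direction from `eX (π j) j (F_{π j}) ⊆ F_j`; `piTransport_pi_apply` ∕ `piTransport_mem_map` — for
  `loc_T = (loc_i)_i : H → Π X_i` equivariant for an endomorphism `c` of `H`
  (`loc_j ∘ c = eX (π j) j ∘ loc_{π j}`), `τ_X ∘ loc_T = loc_T ∘ c` and `loc_T(S)` is `τ_X`-stable for
  every `c`-stable `S`.
* §2 `map_inf_ker_sub_id_eq` ∕ `map_inf_ker_add_id_eq` — **`loc_T(S) ∩ X^± = loc_T(S ∩ H^±)`** for `c` an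
  involution on `H` killed by an odd `n` (`2` invertible): the `±`-parts of the image of a Selmer group
  are the images of the `±`-Selmer modules `𝓗^± = S ∩ H^±` (Jetchev's `𝓗_𝓖^{±}`, §6.2) — the currency of
  `JET.Section6` (`locq : A' →+ Q` on `A' = 𝓗^{−ε}`).
* §3 `relIndex_mul_relIndex_eq_of_iInf_ker_sup_plus_of_piTransport` ∕ `…_minus_of_piTransport` —
  **the signed counting identities for product groups with every `τ`-hypothesis discharged from
  per-place data**: round trips, local adjointness, per-place stability of `F_i ≤ G_i`, equivariance
  of `loc_T`, `loc'_T`, and stability of the global subgroups `S` under `c`, `S'` under `c'`; the remaining inputs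
  are those of the unsigned theorem (perfectness, `n X = 0 = n Y`, `(L + F)^⊥ = L' + G^⊥` — the
  latter is `GlobalDuality.iInf_ker_map_sup_pi_eq`, p482172).

What remains of S1 after this file is GALOIS ONLY and PER PLACE: the local conjugation maps
`H¹(K_v, E[n]) → H¹(K_{σv}, E[n])` on the tree's `galoisCohomology (ρ.toLocal v) 1`, their round trip for
`σ² = 1`, `loc_v ∘ conjAct = conj_v ∘ loc_{σ⁻¹v}`, transport of the local conditions, and the adjointness
of the local Tate pairings under conjugation (`inv_{σv} ∘ σ_* = inv_v`).

References (locators only; no cited FACT is declared): [cite: Jetchev2008, §5 Thm. 5.1, Lemma 5.2 (iii)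
(p. 822), §6.2 (p. 823)] [cite: CasselsFrohlichANT1967, Ch. VII §1.1] [cite: GrossLMS1991, §5 (5.1),
Prop. 5.4 (ii)] [cite: MilneADT2006, Ch. I §0 (0.19)].
Design: no definitions; `Type*`-polymorphic; dependent rewriting along `π (π j) = j` by `subst`.
Axioms: `propext`, `Classical.choice`, `Quot.sound`.
-/

set_option autoImplicit false

noncomputable section

open scoped Classical
open Function
open Literature.NumberTheory.GaloisRepresentations

namespace Summit.BirchSwinnertonDyer.Rank1Residual.JET.GlobalDuality

/-! ### §1 The involution on a product induced by a permutation of the index set and transports -/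

section PiTransport

variable {ι : Type*} {X : ι → Type*} [∀ i, AddCommGroup (X i)] (π : ι → ι)
  (eX : ∀ i j, X i →+ X j)

/-- The endomorphism `(τ_X x)_j = eX (π j) j (x_{π j})` of `Π_i X_i` exists (it is
`AddMonoidHom.pi` of `eX (π j) j ∘ ev_{π j}`); recorded so that consumers can obtain a `τ_X`
satisfying the pointwise hypothesis `hτX` used throughout this file. -/
theorem piTransport_exists :
    ∃ τX : (∀ i, X i) →+ (∀ i, X i), ∀ x j, τX x j = eX (π j) j (x (π j)) :=
  ⟨AddMonoidHom.pi fun j => (eX (π j) j).comp (Pi.evalAddMonoidHom X (π j)), fun _ _ => rfl⟩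

variable (τX : (∀ i, X i) →+ (∀ i, X i)) (hτX : ∀ x j, τX x j = eX (π j) j (x (π j)))
include hτX

/-- **`τ_X` is an involution** when `π` is one and the transports make the round trip
`eX (π j) j (eX j (π j) y) = y` at every index (in the source: `σ_* ∘ σ_* = (σ²)_* = id` on
`H¹(K_v, ·)` for `σ² = 1`). Dependent rewriting along `π (π j) = j` by `subst`. -/
theorem piTransport_involutive (hπ : Involutive π)
    (hround : ∀ j (y : X j), eX (π j) j (eX j (π j) y) = y) (x : ∀ i, X i) : τX (τX x) = x := by
  funext j
  rw [hτX, hτX]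
  have key : ∀ i, i = j → eX (π j) j (eX i (π j) (x i)) = x j := by
    rintro i rfl
    exact hround _ (x _)
  exact key _ (hπ j)

/-- **A product of subgroups `Π_i F_i` is `τ_X`-stable** when the transports carry `F_{π j}` into `F_j`
(in the source: `σ_*` carries the local condition at `v` to the one at `σ v`, e.g.
`conjAct_mem_selmerLocalKer_iff` for the Kummer condition). -/
theorem piTransport_mem_pi (F : ∀ i, AddSubgroup (X i))
    (hF : ∀ j (y : X (π j)), y ∈ F (π j) → eX (π j) j y ∈ F j)
    (s : ∀ i, X i) (hs : s ∈ AddSubgroup.pi Set.univ F) : τX s ∈ AddSubgroup.pi Set.univ F := by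
  rw [AddSubgroup.mem_pi] at hs ⊢
  intro j _
  rw [hτX]
  exact hF j _ (hs _ (Set.mem_univ _))

variable {H : Type*} [AddCommGroup H] (c : H →+ H) (loc : ∀ i, H →+ X i) (locT : H →+ ∀ i, X i)
  (hlocT : ∀ h i, locT h i = loc i h) (hequiv : ∀ j h, loc j (c h) = eX (π j) j (loc (π j) h))
include hlocT hequiv

/-- **Equivariance in product form**: if `loc_j ∘ c = eX (π j) j ∘ loc_{π j}` at every index (in the
source: `loc_v ∘ σ_* = σ_* ∘ loc_{σ⁻¹ v}` on `H¹(K, ·) → H¹(K_v, ·)`), then `τ_X (loc_T h) = loc_T (c h)`. -/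
theorem piTransport_pi_apply (h : H) : τX (locT h) = locT (c h) := by
  funext j
  rw [hτX, hlocT, hlocT, hequiv]

/-- **The image `loc_T(S)` of a `c`-stable subgroup is `τ_X`-stable** (in the source: the localisation
image of a `Gal(K/ℚ)`-stable Selmer group, `conjAct_mem_selmerGroup`). -/
theorem piTransport_mem_map (S : AddSubgroup H) (hS : ∀ s ∈ S, c s ∈ S)
    (u : ∀ i, X i) (hu : u ∈ S.map locT) : τX u ∈ S.map locT := by
  obtain ⟨s, hs, rfl⟩ := hu
  exact ⟨c s, hS s hs, (piTransport_pi_apply π eX τX hτX c loc locT hlocT hequiv s).symm⟩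

/-- `loc_T` carries the `+1`-eigen-subgroup of `c` into that of `τ_X`. -/
theorem pi_mem_ker_sub_id_of_mem (h : H) (hh : h ∈ (c - AddMonoidHom.id H).ker) :
    locT h ∈ (τX - AddMonoidHom.id _).ker := by
  rw [mem_ker_sub_id_iff] at hh ⊢
  rw [piTransport_pi_apply π eX τX hτX c loc locT hlocT hequiv, hh]

/-- `loc_T` carries the `−1`-eigen-subgroup of `c` into that of `τ_X`. -/
theorem pi_mem_ker_add_id_of_mem (h : H) (hh : h ∈ (c + AddMonoidHom.id H).ker) :
    locT h ∈ (τX + AddMonoidHom.id _).ker := by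
  rw [mem_ker_add_id_iff] at hh ⊢
  rw [piTransport_pi_apply π eX τX hτX c loc locT hlocT hequiv, hh, map_neg]

end PiTransport

section PiTransportPairing

variable {ι : Type*} [Fintype ι] {X Y : ι → Type*} [∀ i, AddCommGroup (X i)]
  [∀ i, AddCommGroup (Y i)] {R : Type*} [AddCommMonoid R] (π : ι → ι)
  (eX : ∀ i j, X i →+ X j) (eY : ∀ i j, Y i →+ Y j)
  (τX : (∀ i, X i) →+ (∀ i, X i)) (τY : (∀ i, Y i) →+ (∀ i, Y i))
  (hτX : ∀ x j, τX x j = eX (π j) j (x (π j))) (hτY : ∀ y j, τY y j = eY (π j) j (y (π j)))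
  (b : ∀ i, X i →+ Y i →+ R) (bS : (∀ i, X i) →+ (∀ i, Y i) →+ R)
  (hbS : ∀ x y, bS x y = ∑ i, b i (x i) (y i))
include hτX hτY hbS

/-- **The sum pairing is `(τ_X, τ_Y)`-invariant**: `∑_j b_j ((τ_X x)_j) ((τ_Y y)_j) = ∑_i b_i (x_i) (y_i)`
when `π` is an involution and the transports are adjoint place by place,
`b_j (eX (π j) j x) (eY (π j) j y) = b_{π j} x y` (in the source: the local Tate pairings satisfy
`inv_{σ v}(σ_* x ∪ σ_* y) = inv_v(x ∪ y)`); the proof reindexes the sum by `π`.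
[cite: Jetchev2008, Thm. 5.1 (p. 822) «with respect to `∑_v ⟨,⟩_v^±`»] -/
theorem sum_pairing_piTransport (hπ : Involutive π)
    (hb : ∀ j (x : X (π j)) (y : Y (π j)), b j (eX (π j) j x) (eY (π j) j y) = b (π j) x y)
    (x : ∀ i, X i) (y : ∀ i, Y i) : bS (τX x) (τY y) = bS x y := by
  rw [hbS, hbS]
  simp_rw [hτX, hτY, hb]
  exact Fintype.sum_equiv hπ.toPerm _ _ fun _ => rfl

end PiTransportPairing

/-! ### §2 `±`-parts of an image: `loc_T(S) ∩ X^± = loc_T(S ∩ H^±)` (`2` invertible) -/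

section ImageParts

variable {ι : Type*} {X : ι → Type*} [∀ i, AddCommGroup (X i)] (π : ι → ι)
  (eX : ∀ i j, X i →+ X j) (τX : (∀ i, X i) →+ (∀ i, X i))
  (hτX : ∀ x j, τX x j = eX (π j) j (x (π j)))
  {H : Type*} [AddCommGroup H] (c : H →+ H) (loc : ∀ i, H →+ X i) (locT : H →+ ∀ i, X i)
  (hlocT : ∀ h i, locT h i = loc i h) (hequiv : ∀ j h, loc j (c h) = eX (π j) j (loc (π j) h))
  {n : ℕ} (hn : Odd n) (hH : ∀ h : H, n • h = 0) (hX : ∀ x : ∀ i, X i, n • x = 0)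
  (hc : ∀ h, c (c h) = h)
include hτX hlocT hequiv hn hH hX hc

/-- **`loc_T(S) ∩ X⁺ = loc_T(S ∩ H⁺)`** for a `c`-stable `S`, `c` an involution, everything killed by an
odd `n`: if `loc_T s` is `τ_X`-fixed, split `s = s⁺ + s⁻` inside `S` (`le_inf_sup_inf_of_stable`);
then `loc_T s⁻ = loc_T s − loc_T s⁺ ∈ X⁺ ∩ X⁻ = 0`, so `loc_T s = loc_T s⁺`. (The `±`-parts of the image
of a Selmer group are the images of the `±`-Selmer modules `𝓗^± = S ∩ H^±`, Jetchev 2008 §6.2.)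
[cite: Jetchev2008, §6.2 (p. 823)] [cite: GrossLMS1991, Prop. 5.4 (ii)] -/
theorem map_inf_ker_sub_id_eq (S : AddSubgroup H) (hS : ∀ s ∈ S, c s ∈ S) :
    S.map locT ⊓ (τX - AddMonoidHom.id _).ker =
      (S ⊓ (c - AddMonoidHom.id H).ker).map locT := by
  apply le_antisymm
  · intro u hu'
    obtain ⟨⟨s, hs, rfl⟩, hu⟩ := AddSubgroup.mem_inf.mp hu'
    obtain ⟨a, ha, b, hb, hab⟩ :=
      AddSubgroup.mem_sup.mp (le_inf_sup_inf_of_stable c hn hH hc hS hs)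
    have hbX : locT b ∈ (τX - AddMonoidHom.id _).ker ⊓ (τX + AddMonoidHom.id _).ker := by
      refine AddSubgroup.mem_inf.mpr ⟨?_, pi_mem_ker_add_id_of_mem π eX τX hτX c loc locT hlocT hequiv b hb.2⟩
      have : locT b = locT s - locT a := by rw [← hab, map_add]; abel
      rw [this]
      exact sub_mem hu (pi_mem_ker_sub_id_of_mem π eX τX hτX c loc locT hlocT hequiv a ha.2)
    rw [ker_sub_id_inf_ker_add_id_eq_bot τX hn hX, AddSubgroup.mem_bot] at hbX
    refine ⟨a, ha, ?_⟩
    rw [← hab, map_add, hbX, add_zero]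
  · rintro u ⟨a, ha, rfl⟩
    exact ⟨⟨a, ha.1, rfl⟩, pi_mem_ker_sub_id_of_mem π eX τX hτX c loc locT hlocT hequiv a ha.2⟩

/-- **`loc_T(S) ∩ X⁻ = loc_T(S ∩ H⁻)`** (the `−1`-eigenspace twin; Jetchev's `−ε(c)` side).
[cite: Jetchev2008, §6.2 (p. 823), proof of Thm. 6.3] -/
theorem map_inf_ker_add_id_eq (S : AddSubgroup H) (hS : ∀ s ∈ S, c s ∈ S) :
    S.map locT ⊓ (τX + AddMonoidHom.id _).ker =
      (S ⊓ (c + AddMonoidHom.id H).ker).map locT := by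
  apply le_antisymm
  · intro u hu'
    obtain ⟨⟨s, hs, rfl⟩, hu⟩ := AddSubgroup.mem_inf.mp hu'
    obtain ⟨a, ha, b, hb, hab⟩ :=
      AddSubgroup.mem_sup.mp (le_inf_sup_inf_of_stable c hn hH hc hS hs)
    have haX : locT a ∈ (τX - AddMonoidHom.id _).ker ⊓ (τX + AddMonoidHom.id _).ker := by
      refine AddSubgroup.mem_inf.mpr ⟨pi_mem_ker_sub_id_of_mem π eX τX hτX c loc locT hlocT hequiv a ha.2, ?_⟩
      have : locT a = locT s - locT b := by rw [← hab, map_add]; abel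
      rw [this]
      exact sub_mem hu (pi_mem_ker_add_id_of_mem π eX τX hτX c loc locT hlocT hequiv b hb.2)
    rw [ker_sub_id_inf_ker_add_id_eq_bot τX hn hX, AddSubgroup.mem_bot] at haX
    refine ⟨b, hb, ?_⟩
    rw [← hab, map_add, haX, zero_add]
  · rintro u ⟨b, hb, rfl⟩
    exact ⟨⟨b, hb.1, rfl⟩, pi_mem_ker_add_id_of_mem π eX τX hτX c loc locT hlocT hequiv b hb.2⟩

end ImageParts

/-! ### §3 The signed counting identities for product groups, from per-place data -/

section SignedPi

variable {ι : Type*} [Fintype ι] {X Y : ι → Type*} [∀ i, AddCommGroup (X i)]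
  [∀ i, AddCommGroup (Y i)] [∀ i, Finite (X i)] [∀ i, Finite (Y i)] {n : ℕ} [NeZero n] (hn : Odd n)
  -- the pairing: sum of local pairings, perfect
  (b : ∀ i, X i →+ Y i →+ ZMod n) (bS : (∀ i, X i) →+ (∀ i, Y i) →+ ZMod n)
  (hbS : ∀ x y, bS x y = ∑ i, b i (x i) (y i))
  (hX : ∀ x : ∀ i, X i, n • x = 0) (hY : ∀ y : ∀ i, Y i, n • y = 0)
  (hl : Injective bS) (hr : Injective bS.flip)
  -- the place involution and the transports
  (π : ι → ι) (hπ : Involutive π) (eX : ∀ i j, X i →+ X j) (eY : ∀ i j, Y i →+ Y j)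
  (hroundX : ∀ j (y : X j), eX (π j) j (eX j (π j) y) = y)
  (hroundY : ∀ j (y : Y j), eY (π j) j (eY j (π j) y) = y)
  (hb : ∀ j (x : X (π j)) (y : Y (π j)), b j (eX (π j) j x) (eY (π j) j y) = b (π j) x y)
  (τX : (∀ i, X i) →+ (∀ i, X i)) (τY : (∀ i, Y i) →+ (∀ i, Y i))
  (hτX : ∀ x j, τX x j = eX (π j) j (x (π j))) (hτY : ∀ y j, τY y j = eY (π j) j (y (π j)))
  -- the local conditions `F_i ≤ G_i`, transported into themselves
  (F G : ∀ i, AddSubgroup (X i)) (hFG : ∀ i, F i ≤ G i)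
  (sF : ∀ j (y : X (π j)), y ∈ F (π j) → eX (π j) j y ∈ F j)
  (sG : ∀ j (y : X (π j)), y ∈ G (π j) → eX (π j) j y ∈ G j)
  -- the global sides: `L = loc_T(S)`, `L' = loc'_T(S')`, equivariant, `S`, `S'` stable
  {H H' : Type*} [AddCommGroup H] [AddCommGroup H'] (c : H →+ H) (c' : H' →+ H')
  (loc : ∀ i, H →+ X i) (locT : H →+ ∀ i, X i) (hlocT : ∀ h i, locT h i = loc i h)
  (hequiv : ∀ j h, loc j (c h) = eX (π j) j (loc (π j) h))
  (loc' : ∀ i, H' →+ Y i) (locT' : H' →+ ∀ i, Y i) (hlocT' : ∀ h i, locT' h i = loc' i h)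
  (hequiv' : ∀ j h, loc' j (c' h) = eY (π j) j (loc' (π j) h))
  (S : AddSubgroup H) (hS : ∀ s ∈ S, c s ∈ S) (S' : AddSubgroup H') (hS' : ∀ s ∈ S', c' s ∈ S')
  -- the annihilator identity `(L + F)^⊥ = L' + G^⊥`
  (hann : (⨅ s ∈ S.map locT ⊔ AddSubgroup.pi Set.univ F, (bS s).ker : AddSubgroup (∀ i, Y i)) =
    S'.map locT' ⊔ ⨅ s ∈ AddSubgroup.pi Set.univ G, (bS s).ker)
include hn hbS hX hY hl hr hπ hroundX hroundY hb hτX hτY hFG sF sG hlocT hequiv hlocT' hequiv' hS hS'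
  hann

/-- **Signed Poitou–Tate counting for product groups, `+` side, from per-place data**: with
`X = Π_i X_i`, `Y = Π_i Y_i`, `bS = ∑_i b_i` perfect, an involution `π` of the index set, transports
making the round trips and adjoint for the `b_i`, local conditions `F_i ≤ G_i` transported into
themselves, and `L = loc_T(S)`, `L' = loc'_T(S')` for equivariant `loc_T`, `loc'_T` and `c`-∕`c'`-stable
`S`, `S'` with `(L + ΠF_i)^⊥ = L' + (ΠG_i)^⊥`:
`(ΠF_i).relIndex (L ∩ X⁺) · (ΠG_i)^⊥.relIndex (L' ∩ Y⁺) = (ΠF_i).relIndex (ΠG_i ∩ X⁺)`.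
All `τ`-hypotheses of `relIndex_mul_relIndex_eq_of_iInf_ker_sup_plus` are discharged by §1.
[cite: Jetchev2008, Thm. 5.1 (p. 822), Lemma 5.2 (iii)] [cite: MilneADT2006, Ch. I §0 (0.19)] -/
theorem relIndex_mul_relIndex_eq_of_iInf_ker_sup_plus_of_piTransport :
    (AddSubgroup.pi Set.univ F).relIndex (S.map locT ⊓ (τX - AddMonoidHom.id _).ker) *
        (⨅ s ∈ AddSubgroup.pi Set.univ G, (bS s).ker : AddSubgroup (∀ i, Y i)).relIndex
          (S'.map locT' ⊓ (τY - AddMonoidHom.id _).ker) =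
      (AddSubgroup.pi Set.univ F).relIndex
        (AddSubgroup.pi Set.univ G ⊓ (τX - AddMonoidHom.id _).ker) :=
  relIndex_mul_relIndex_eq_of_iInf_ker_sup_plus hn bS hX hY hl hr τX τY
    (piTransport_involutive π eX τX hτX hπ hroundX) (piTransport_involutive π eY τY hτY hπ hroundY)
    (sum_pairing_piTransport π eX eY τX τY hτX hτY b bS hbS hπ hb)
    (AddSubgroup.pi Set.univ F) (AddSubgroup.pi Set.univ G) (S.map locT) (S'.map locT')
    (fun _ hs => (AddSubgroup.mem_pi _).mpr fun i hi => hFG i ((AddSubgroup.mem_pi _).mp hs i hi))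
    (piTransport_mem_pi π eX τX hτX F sF)
    (piTransport_mem_pi π eX τX hτX G sG)
    (piTransport_mem_map π eX τX hτX c loc locT hlocT hequiv S hS)
    (piTransport_mem_map π eY τY hτY c' loc' locT' hlocT' hequiv' S' hS') hann

/-- **Signed Poitou–Tate counting for product groups, `−` side, from per-place data** (Jetchev's
`−ε(c)` side, the one carrying the inequality of Thm. 6.3):
`(ΠF_i).relIndex (L ∩ X⁻) · (ΠG_i)^⊥.relIndex (L' ∩ Y⁻) = (ΠF_i).relIndex (ΠG_i ∩ X⁻)`.
[cite: Jetchev2008, Thm. 5.1 (p. 822), Lemma 5.2 (iii), proof of Thm. 6.3 (p. 823)] -/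
theorem relIndex_mul_relIndex_eq_of_iInf_ker_sup_minus_of_piTransport :
    (AddSubgroup.pi Set.univ F).relIndex (S.map locT ⊓ (τX + AddMonoidHom.id _).ker) *
        (⨅ s ∈ AddSubgroup.pi Set.univ G, (bS s).ker : AddSubgroup (∀ i, Y i)).relIndex
          (S'.map locT' ⊓ (τY + AddMonoidHom.id _).ker) =
      (AddSubgroup.pi Set.univ F).relIndex
        (AddSubgroup.pi Set.univ G ⊓ (τX + AddMonoidHom.id _).ker) :=
  relIndex_mul_relIndex_eq_of_iInf_ker_sup_minus hn bS hX hY hl hr τX τY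
    (piTransport_involutive π eX τX hτX hπ hroundX) (piTransport_involutive π eY τY hτY hπ hroundY)
    (sum_pairing_piTransport π eX eY τX τY hτX hτY b bS hbS hπ hb)
    (AddSubgroup.pi Set.univ F) (AddSubgroup.pi Set.univ G) (S.map locT) (S'.map locT')
    (fun _ hs => (AddSubgroup.mem_pi _).mpr fun i hi => hFG i ((AddSubgroup.mem_pi _).mp hs i hi))
    (piTransport_mem_pi π eX τX hτX F sF)
    (piTransport_mem_pi π eX τX hτX G sG)
    (piTransport_mem_map π eX τX hτX c loc locT hlocT hequiv S hS)
    (piTransport_mem_map π eY τY hτY c' loc' locT' hlocT' hequiv' S' hS') hann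

end SignedPi

end Summit.BirchSwinnertonDyer.Rank1Residual.JET.GlobalDuality

end
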